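import Summits.QuantumFields.BalabanUV.Beta.D1BFx.GhostDeltaJetLetters
import Summits.QuantumFields.BalabanUV.Beta.D1BFx.GhostAveragingSquare

/-!
# The «ΔGH» jets, II: the plain mass of the packed `Q′*Q′` table decays in the coarse separation and is `O(n⁻⁵)` per colour pair

Road «BF-x» (BetaPertH (D1) dictionary chain), unit `b2b-balaban-beta-d1-formalise-leaf-04` (gen 18), «RK-GH-UNIT» FILE 5c (OWNER RULING
ρ-g16-2 «ΔGH DIRECT»). The stripped square table `qSqAt ρ n κ′ u λ′ u′ = qAntiAt ρ n κ′ u · qAntiAt ρ n λ′ u′` (pointwise) packed against the two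
minimiser weights at the coarse sites `0` and `z`, `tableRedF n (qSqAt ρ n) μ 0 ν z`, has — for every in-block root `ρ` — a summable PLAIN ℓ¹-mass

  `Σ'_{(x,z′)} |tableRedF n (qSqAt ρ n) μ 0 ν z x z′| ≤ 64·e^{κ₁}·(M·P·e^{κ₁})²·(1 + 16∕κ₁)⁴ · (n⁵)⁻¹ · e^{−(κ₁∕8)|z|₁}`

(`κ₁ = kappa163 4∕4`, `M·P = MG163 4·periodConst (kappa163 4) 3`; **power `n⁻⁵`** before the table's own weight `x₀·cQ·n⁴`, i.e. `W_Q` is `O(|x₀cQ|·n⁻¹)`,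
FILE 5d). THE COUNT: the two stripped kernels of one entry must share a block (`mass_qSqAt_le`: `≤ [blk u′ = blk u]·2n⁻⁴·D(u)`), so the two weights
are evaluated at block-mates `u`, `u′` — their product carries the coarse decay `e^{κ₁∕2}·e^{−(κ₁∕8)|z|₁}` and still one slow exponential in `u`
(`abs_wH_mul_wH_blk_le`); the rest is FILE 5b's block count: `n⁻¹⁰ (two envelopes) × n⁻⁴ (one stripped kernel's sup) × n⁴ (the block-mates u′)
× n⁻⁴·n⁴(n − 1) (block averaging × block needle total) × n⁴ (Zl) = n⁻⁵·(n − 1)∕n`.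
CONTENT ([folklore]): §1 `mass_qSqAt_le`, `mass_innerWsum_qSqAt_le`; §2 `abs_wH_mul_wH_blk_le`, **`tsum_wH_tableStencilMass_le`**; §3 `tableRedF_eq_sum_pairs`,
**`mass_tableRedF_qSqAt_le`**. 0 sorry ∕ new def ∕ `def … : Prop` ∕ cite. HONEST: estimates about OUR packed objects; 0 root-level binders
discharged; (K) NOT closed; NOT D1, NOT BetaPertH, NOT continuum, NOT Clay.
-/

open Finset
open scoped BigOperators
open Literature.MathematicalPhysics.QuantumFieldTheory.Balaban1983to89
open Literature.MathematicalPhysics.QuantumFieldTheory.Balaban1983to89.Beta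
open B12Sec2to5 (l1 l1_nonneg)
open B5Hk163Strip (kappa163 kappa163_pos)
open B5Hk163Decay (MG163)
open B4TorusKernel (periodConst)
open B6QGQLower276 (blk B mem_B)
open ExpKernelCalculus (Site MKer Zl Zl_nonneg tsum_exp_shift' summable_exp_shift' l1_sub_triangle l1_sub_symm l1_natSmul)
open KernelSpecInstance (wH)
open OneStepResolventKernel (wsum)
open Summit.QuantumFields.BalabanUV.Beta.D1BFx.GhostStencil (l1_sub_le_of_blk_eq)
open Summit.QuantumFields.BalabanUV.Beta.D1BFx.GhostStencilRooted (qJetAt qAntiAt)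
open Summit.QuantumFields.BalabanUV.Beta.D1BFx.GhostNeedleRootedLetters (abs_qAntiAt_le sum_B_const')
open Summit.QuantumFields.BalabanUV.Beta.D1BFx.GhostAveragingSquare (qSqAt qSqAt_apply)
open Summit.QuantumFields.BalabanUV.Beta.D1BFx.NeedleRowLetters (tsum_eq_tsum_blocks hasSum_blocks)
open Summit.QuantumFields.BalabanUV.Beta.D1BFx.ReducedTableF (tableRedF tableRedF_apply)
open Summit.QuantumFields.BalabanUV.Beta.D1BFx.RestJetEnvelopes (abs_wH_fine_le)
open Summit.QuantumFields.BalabanUV.Beta.D1BFx.GhostWordJetMass (mass_wsum_le mass_finset_sum_le)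
open Summit.QuantumFields.BalabanUV.Beta.D1BFx.GhostWordJetLetters (wH_const_nonneg Zl_kappa_le)
open Summit.QuantumFields.BalabanUV.Beta.D1BFx.GhostDeltaJetLetters (qAntiAt_eq_zero_of_not_blk mass_qAntiAt_stencil_le sum_B_D_le D_le
  exp_le_blockAvg)

namespace Summit.QuantumFields.BalabanUV.Beta.D1BFx.GhostDeltaTableMass

/-! ## §1 One entry of the stripped square table -/

section Entry
variable (ρ : Site 4) (n : ℕ) [NeZero n] (κ' l' : Fin 4)

/-- [folklore] **ONE ENTRY'S PLAIN MASS**: the two stripped kernels of `qSqAt ρ n κ′ u λ′ u′` live on the block squares of `u` and of `u′`, so the entry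
vanishes unless `blk u′ = blk u`, and then `|qAntiAt λ′ u′| ≤ 2n⁻⁴` leaves the first kernel's plain mass `≤ D(u)` (FILE 5b's `mass_qAntiAt_stencil_le`
at `σ = 0`): `Σ' |qSqAt ρ n κ′ u λ′ u′| ≤ [blk u′ = blk u]·(2n⁻⁴·D(u))`. -/
theorem mass_qSqAt_le (u u' : Site 4) :
    (Summable fun p : Site 4 × Site 4 => ∑ a, ∑ b, |qSqAt ρ n κ' u l' u' p.1 p.2 a b| * (1 : ℝ)) ∧
      ∑' p : Site 4 × Site 4, ∑ a, ∑ b, |qSqAt ρ n κ' u l' u' p.1 p.2 a b| * (1 : ℝ)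
        ≤ if blk (n - 1) u' = blk (n - 1) u then
            2 * ((n : ℝ) ^ 4)⁻¹ * ∑ x ∈ B (n - 1) (blk (n - 1) u), ∑ z ∈ B (n - 1) (blk (n - 1) u),
              (|qJetAt ρ n κ' u (blk (n - 1) u) z| + |qJetAt ρ n κ' u (blk (n - 1) u) x|)
          else 0 := by
  have h0 := mass_qAntiAt_stencil_le ρ n κ' (le_refl (0 : ℝ)) 0 u
  simp only [zero_mul, Real.exp_zero, one_mul] at h0
  have hn : (0 : ℝ) < (n : ℝ) ^ 4 := by have : (0 : ℝ) < n := Nat.cast_pos.mpr (Nat.pos_of_ne_zero (NeZero.ne n)); positivity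
  by_cases hb : blk (n - 1) u' = blk (n - 1) u
  · rw [if_pos hb]
    have hnn : ∀ p : Site 4 × Site 4, 0 ≤ ∑ a, ∑ b, |qSqAt ρ n κ' u l' u' p.1 p.2 a b| * (1 : ℝ) :=
      fun p => Finset.sum_nonneg fun a _ => Finset.sum_nonneg fun b _ => by positivity
    have hle : ∀ p : Site 4 × Site 4, ∑ a, ∑ b, |qSqAt ρ n κ' u l' u' p.1 p.2 a b| * (1 : ℝ)
        ≤ 2 * ((n : ℝ) ^ 4)⁻¹ * (∑ a, ∑ b, |qAntiAt ρ n κ' u p.1 p.2 a b| * (1 : ℝ)) := by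
      rintro ⟨x, z⟩
      rw [Fintype.sum_unique, Fintype.sum_unique, Fintype.sum_unique, Fintype.sum_unique]
      show |qSqAt ρ n κ' u l' u' x z () ()| * 1 ≤ 2 * ((n : ℝ) ^ 4)⁻¹ * (|qAntiAt ρ n κ' u x z () ()| * 1)
      rw [qSqAt_apply, abs_mul, mul_one, mul_one, mul_comm (2 * ((n : ℝ) ^ 4)⁻¹)]
      exact mul_le_mul_of_nonneg_left (abs_qAntiAt_le ρ n l' u' x z () ()) (abs_nonneg _)
    have hs := Summable.of_nonneg_of_le hnn hle (h0.1.mul_left _)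
    refine ⟨hs, (hs.tsum_le_tsum hle (h0.1.mul_left _)).trans ?_⟩
    rw [tsum_mul_left]
    exact mul_le_mul_of_nonneg_left h0.2 (by positivity)
  · rw [if_neg hb]
    have hz : (fun p : Site 4 × Site 4 => ∑ a, ∑ b, |qSqAt ρ n κ' u l' u' p.1 p.2 a b| * (1 : ℝ)) = fun _ => 0 := by
      funext p
      rw [Fintype.sum_unique, Fintype.sum_unique]
      show |qSqAt ρ n κ' u l' u' p.1 p.2 () ()| * 1 = 0
      rw [qSqAt_apply]
      by_cases hx : blk (n - 1) p.1 = blk (n - 1) u ∧ blk (n - 1) p.2 = blk (n - 1) u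
      · rw [qAntiAt_eq_zero_of_not_blk ρ n l' u' (fun h' => hb (h'.1.symm.trans hx.1)), mul_zero, abs_zero, zero_mul]
      · rw [qAntiAt_eq_zero_of_not_blk ρ n κ' u hx, zero_mul, abs_zero, zero_mul]
    rw [hz, tsum_zero]
    exact ⟨summable_zero, le_rfl⟩

/-- [folklore] **THE INNER SUPERPOSITION** (over the second bond `u′`, weights `w′`): its plain mass is `≤ (2n⁻⁴·D(u)) · Σ_{u′ ∈ B(blk u)} |w′ u′|` —
only the block-mates of `u` contribute. -/
theorem mass_innerWsum_qSqAt_le (w' : Site 4 → ℝ) (u : Site 4) :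
    (Summable fun p : Site 4 × Site 4 => ∑ a, ∑ b, |wsum w' (qSqAt ρ n κ' u l') p.1 p.2 a b| * (1 : ℝ)) ∧
      ∑' p : Site 4 × Site 4, ∑ a, ∑ b, |wsum w' (qSqAt ρ n κ' u l') p.1 p.2 a b| * (1 : ℝ)
        ≤ (2 * ((n : ℝ) ^ 4)⁻¹ * ∑ x ∈ B (n - 1) (blk (n - 1) u), ∑ z ∈ B (n - 1) (blk (n - 1) u),
              (|qJetAt ρ n κ' u (blk (n - 1) u) z| + |qJetAt ρ n κ' u (blk (n - 1) u) x|)) *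
            ∑ u' ∈ B (n - 1) (blk (n - 1) u), |w' u'| := by
  set Dn : ℝ := 2 * ((n : ℝ) ^ 4)⁻¹ * ∑ x ∈ B (n - 1) (blk (n - 1) u), ∑ z ∈ B (n - 1) (blk (n - 1) u),
      (|qJetAt ρ n κ' u (blk (n - 1) u) z| + |qJetAt ρ n κ' u (blk (n - 1) u) x|) with hDn
  set ρ' : Site 4 → ℝ := fun u' => if blk (n - 1) u' = blk (n - 1) u then Dn else 0 with hρ'
  have hws : Summable fun u' => |w' u'| * ρ' u' := by
    refine summable_of_ne_finset_zero (s := B (n - 1) (blk (n - 1) u)) fun u' hu' => ?_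
    have h : ¬ blk (n - 1) u' = blk (n - 1) u := fun h => hu' (mem_B.2 h)
    simp only [hρ', if_neg h, mul_zero]
  have h := mass_wsum_le (F := Unit) (W := fun _ => (1 : ℝ)) (K := qSqAt ρ n κ' u l') (w := w') (ρ := ρ') (fun _ => one_pos)
    (fun u' => (mass_qSqAt_le ρ n κ' l' u u').1) (fun u' => (mass_qSqAt_le ρ n κ' l' u u').2) hws
  refine ⟨h.1, h.2.trans (le_of_eq ?_)⟩
  rw [tsum_eq_sum (s := B (n - 1) (blk (n - 1) u)) (fun u' hu' => by
    have h : ¬ blk (n - 1) u' = blk (n - 1) u := fun h => hu' (mem_B.2 h)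
    simp only [hρ', if_neg h, mul_zero]), Finset.mul_sum]
  refine Finset.sum_congr rfl fun u' hu' => ?_
  simp only [hρ', if_pos (mem_B.1 hu'), mul_comm]

end Entry

/-! ## §2 The two weights at block-mates, and the stencil sum -/

section StencilSum
variable (m : ℕ)

/-- [folklore] **TWO WEIGHTS AT BLOCK-MATES CARRY THE COARSE DECAY**: for `blk u′ = blk u`,
`|wH κ′ μ (u − n•0)|·|wH λ′ ν (u′ − n•z)| ≤ C·C·e^{κ₁∕2}·e^{−(κ₁∕8)|z|₁}·e^{−(κ₁∕(8n))|u − n•0|₁}` (`n|z|₁ ≤ |u′ − n•z|₁ + 4n + |u − n•0|₁`). -/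
theorem abs_wH_mul_wH_blk_le (κ' l' μ ν : Fin 4) (z u u' : Site 4) (h : blk (m + 1 - 1) u' = blk (m + 1 - 1) u) :
    |wH (d := 3) (N := m + 1) κ' μ (u - ((m + 1 : ℕ) : ℤ) • (0 : Site 4))| * |wH (d := 3) (N := m + 1) l' ν (u' - ((m + 1 : ℕ) : ℤ) • z)|
      ≤ (((((m + 1 : ℕ) : ℝ)) ^ (3 + 2))⁻¹ * (MG163 (3 + 1) * periodConst (kappa163 (3 + 1)) 3) * Real.exp (kappa163 (3 + 1) / (3 + 1))) *
        (((((m + 1 : ℕ) : ℝ)) ^ (3 + 2))⁻¹ * (MG163 (3 + 1) * periodConst (kappa163 (3 + 1)) 3) * Real.exp (kappa163 (3 + 1) / (3 + 1))) *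
        Real.exp (kappa163 (3 + 1) / (3 + 1) / 2) * Real.exp (-(kappa163 (3 + 1) / (3 + 1) / 8) * l1 z) *
        Real.exp (-(kappa163 (3 + 1) / (3 + 1) / (8 * ((m + 1 : ℕ) : ℝ))) * l1 (u - ((m + 1 : ℕ) : ℤ) • (0 : Site 4))) := by
  set C : ℝ := ((((m + 1 : ℕ) : ℝ)) ^ (3 + 2))⁻¹ * (MG163 (3 + 1) * periodConst (kappa163 (3 + 1)) 3) * Real.exp (kappa163 (3 + 1) / (3 + 1)) with hC
  have hC0 : 0 ≤ C := wH_const_nonneg m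
  have hn : (0 : ℝ) < ((m + 1 : ℕ) : ℝ) := by exact_mod_cast Nat.succ_pos m
  have hκ := kappa163_pos (3 + 1)
  set r : ℝ := kappa163 (3 + 1) / (3 + 1) / (8 * ((m + 1 : ℕ) : ℝ)) with hr
  have hr0 : 0 < r := by positivity
  have e4 : kappa163 (3 + 1) / (3 + 1) / (4 * ((m + 1 : ℕ) : ℝ)) = 2 * r := by rw [hr]; field_simp; ring
  have hrn : r * ((m + 1 : ℕ) : ℝ) = kappa163 (3 + 1) / (3 + 1) / 8 := by rw [hr]; field_simp
  set c₀ : Site 4 := ((m + 1 : ℕ) : ℤ) • (0 : Site 4) with hc₀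
  set cz : Site 4 := ((m + 1 : ℕ) : ℤ) • z with hcz
  have h1 := abs_wH_fine_le m κ' μ u 0
  have h2 := abs_wH_fine_le m l' ν u' z
  rw [← hC, ← hc₀, e4] at h1
  rw [← hC, ← hcz, e4] at h2
  -- geometry: `n|z|₁ ≤ |u′ − n•z|₁ + 4n + |u − n•0|₁`
  have hgeo : ((m + 1 : ℕ) : ℝ) * l1 z ≤ l1 (u' - cz) + 4 * ((m + 1 : ℕ) : ℝ) + l1 (u - c₀) := by
    have t1 := l1_sub_triangle cz u' c₀
    have t2 := l1_sub_triangle u' u c₀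
    have t3 : l1 (u' - u) ≤ 4 * ((m + 1 : ℕ) : ℝ) := l1_sub_le_of_blk_eq (m + 1) h
    have e1 : l1 (cz - c₀) = ((m + 1 : ℕ) : ℝ) * l1 z := by rw [hcz, hc₀, smul_zero, sub_zero, l1_natSmul]
    have e2 : l1 (cz - u') = l1 (u' - cz) := l1_sub_symm cz u'
    linarith
  have ha := l1_nonneg (u - c₀)
  have hb := l1_nonneg (u' - cz)
  calc |wH (d := 3) (N := m + 1) κ' μ (u - c₀)| * |wH (d := 3) (N := m + 1) l' ν (u' - cz)|
      ≤ (C * Real.exp (-(2 * r) * l1 (u - c₀))) * (C * Real.exp (-(2 * r) * l1 (u' - cz))) :=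
        mul_le_mul h1 h2 (abs_nonneg _) ((abs_nonneg _).trans h1)
    _ = C * C * Real.exp (-(2 * r) * l1 (u - c₀) + -(2 * r) * l1 (u' - cz)) := by rw [Real.exp_add]; ring
    _ ≤ C * C * Real.exp (kappa163 (3 + 1) / (3 + 1) / 2 + -(kappa163 (3 + 1) / (3 + 1) / 8) * l1 z + -r * l1 (u - c₀)) := by
        refine mul_le_mul_of_nonneg_left (Real.exp_le_exp.2 ?_) (mul_nonneg hC0 hC0)
        have hz := mul_le_mul_of_nonneg_left hgeo hr0.le
        rw [← hrn]
        nlinarith [hz, ha, hb, hr0]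
    _ = _ := by rw [Real.exp_add, Real.exp_add]; ring

/-- [folklore] **THE TABLE'S STENCIL SUM** — FILE 5b's block count with the product envelope: for an in-block root `ρ`, every coarse `z` and the
stencil masses `ρ_u := (2n⁻⁴·D(u))·Σ_{u′ ∈ B(blk u)} |wH λ′ ν (u′ − n•z)|` of §1,
`Σ'_u |wH κ′ μ (u − n•0)|·ρ_u ≤ 4·e^{κ₁}·(M·P·e^{κ₁})²·(1 + 16∕κ₁)⁴ · (n⁵)⁻¹ · e^{−(κ₁∕8)|z|₁}`. -/
theorem tsum_wH_tableStencilMass_le {ρ : Site 4} (hρ : ∀ i : Fin 4, 0 ≤ ρ i ∧ ρ i < (m + 1 : ℕ)) (κ' l' μ ν : Fin 4) (z : Site 4) :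
    (Summable fun u : Site 4 => |wH (d := 3) (N := m + 1) κ' μ (u - ((m + 1 : ℕ) : ℤ) • (0 : Site 4))| *
        ((2 * ((((m + 1 : ℕ) : ℕ) : ℝ) ^ 4)⁻¹ *
            ∑ x ∈ B ((m + 1 : ℕ) - 1) (blk ((m + 1 : ℕ) - 1) u), ∑ z' ∈ B ((m + 1 : ℕ) - 1) (blk ((m + 1 : ℕ) - 1) u),
              (|qJetAt ρ (m + 1) κ' u (blk ((m + 1 : ℕ) - 1) u) z'| + |qJetAt ρ (m + 1) κ' u (blk ((m + 1 : ℕ) - 1) u) x|)) *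
          ∑ u' ∈ B ((m + 1 : ℕ) - 1) (blk ((m + 1 : ℕ) - 1) u), |wH (d := 3) (N := m + 1) l' ν (u' - ((m + 1 : ℕ) : ℤ) • z)|)) ∧
      ∑' u : Site 4, |wH (d := 3) (N := m + 1) κ' μ (u - ((m + 1 : ℕ) : ℤ) • (0 : Site 4))| *
        ((2 * ((((m + 1 : ℕ) : ℕ) : ℝ) ^ 4)⁻¹ *
            ∑ x ∈ B ((m + 1 : ℕ) - 1) (blk ((m + 1 : ℕ) - 1) u), ∑ z' ∈ B ((m + 1 : ℕ) - 1) (blk ((m + 1 : ℕ) - 1) u),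
              (|qJetAt ρ (m + 1) κ' u (blk ((m + 1 : ℕ) - 1) u) z'| + |qJetAt ρ (m + 1) κ' u (blk ((m + 1 : ℕ) - 1) u) x|)) *
          ∑ u' ∈ B ((m + 1 : ℕ) - 1) (blk ((m + 1 : ℕ) - 1) u), |wH (d := 3) (N := m + 1) l' ν (u' - ((m + 1 : ℕ) : ℤ) • z)|)
        ≤ 4 * Real.exp (kappa163 (3 + 1) / (3 + 1)) *
            ((MG163 (3 + 1) * periodConst (kappa163 (3 + 1)) 3) * Real.exp (kappa163 (3 + 1) / (3 + 1))) ^ 2 * (1 + 16 / (kappa163 (3 + 1) / (3 + 1))) ^ 4 *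
          ((((m + 1 : ℕ) : ℝ)) ^ 5)⁻¹ * Real.exp (-(kappa163 (3 + 1) / (3 + 1) / 8) * l1 z) := by
  set n : ℕ := m + 1 with hn
  set C : ℝ := ((((m + 1 : ℕ) : ℝ)) ^ (3 + 2))⁻¹ * (MG163 (3 + 1) * periodConst (kappa163 (3 + 1)) 3) * Real.exp (kappa163 (3 + 1) / (3 + 1)) with hC
  have hC0 : 0 ≤ C := wH_const_nonneg m
  have hn0 : (0 : ℝ) < ((m + 1 : ℕ) : ℝ) := by exact_mod_cast Nat.succ_pos m
  have hκ := kappa163_pos (3 + 1)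
  set r : ℝ := kappa163 (3 + 1) / (3 + 1) / (8 * ((m + 1 : ℕ) : ℝ)) with hr
  have hr0 : 0 < r := by positivity
  set c₀ : Site 4 := ((m + 1 : ℕ) : ℤ) • (0 : Site 4) with hc₀
  set P : ℝ := C * C * Real.exp (kappa163 (3 + 1) / (3 + 1) / 2) * Real.exp (-(kappa163 (3 + 1) / (3 + 1) / 8) * l1 z) with hP
  have hP0 : 0 ≤ P := by positivity
  set D : Site 4 → ℝ := fun u => ∑ x ∈ B (n - 1) (blk (n - 1) u), ∑ z' ∈ B (n - 1) (blk (n - 1) u),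
      (|qJetAt ρ n κ' u (blk (n - 1) u) z'| + |qJetAt ρ n κ' u (blk (n - 1) u) x|) with hD
  set A : Site 4 → ℝ := fun u => ∑ u' ∈ B (n - 1) (blk (n - 1) u), |wH (d := 3) (N := m + 1) l' ν (u' - ((m + 1 : ℕ) : ℤ) • z)| with hA
  set E : Site 4 → ℝ := fun β => ∑ u' ∈ B (n - 1) β, Real.exp (-r * l1 (u' - c₀)) with hE
  set S : Site 4 → ℝ := fun u => |wH (d := 3) (N := m + 1) κ' μ (u - c₀)| * ((2 * ((((n : ℕ) : ℕ) : ℝ) ^ 4)⁻¹ * D u) * A u) with hS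
  show Summable S ∧ ∑' u, S u ≤ _
  have hD0 : ∀ u, 0 ≤ D u := fun u => Finset.sum_nonneg fun x _ => Finset.sum_nonneg fun z _ => by positivity
  have hE0 : ∀ β, 0 ≤ E β := fun β => Finset.sum_nonneg fun u _ => (Real.exp_pos _).le
  have hS0 : ∀ u, 0 ≤ S u := fun u => by
    simp only [hS]; exact mul_nonneg (abs_nonneg _) (mul_nonneg (by have := hD0 u; positivity) (Finset.sum_nonneg fun _ _ => abs_nonneg _))
  -- the product envelope summed over the block-mates: `|wH κ′ μ (u − c₀)|·A u ≤ n⁴·P·e^{−r|u − c₀|}`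
  have hWA : ∀ u, |wH (d := 3) (N := m + 1) κ' μ (u - c₀)| * A u ≤ (((m + 1 : ℕ) : ℝ)) ^ 4 * (P * Real.exp (-r * l1 (u - c₀))) := by
    intro u
    simp only [hA]
    rw [Finset.mul_sum]
    calc ∑ u' ∈ B (n - 1) (blk (n - 1) u), |wH (d := 3) (N := m + 1) κ' μ (u - c₀)| * |wH (d := 3) (N := m + 1) l' ν (u' - ((m + 1 : ℕ) : ℤ) • z)|
        ≤ ∑ _u' ∈ B (n - 1) (blk (n - 1) u), P * Real.exp (-r * l1 (u - c₀)) :=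
          Finset.sum_le_sum fun u' hu' => by
            have h := abs_wH_mul_wH_blk_le m κ' l' μ ν z u u' (mem_B.1 hu')
            rw [← hC, ← hc₀, ← hr] at h
            simpa only [hP] using h
      _ = (((m + 1 : ℕ) : ℝ)) ^ 4 * (P * Real.exp (-r * l1 (u - c₀))) := by rw [sum_B_const' (m + 1)]
  -- hence `S u ≤ 2·P·e^{−r|u − c₀|}·D u`
  have hS1 : ∀ u, S u ≤ 2 * P * Real.exp (-r * l1 (u - c₀)) * D u := by
    intro u
    have hn4 : (0 : ℝ) < (((m + 1 : ℕ) : ℝ)) ^ 4 := by positivity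
    calc S u = (2 * ((((n : ℕ) : ℕ) : ℝ) ^ 4)⁻¹ * D u) * (|wH (d := 3) (N := m + 1) κ' μ (u - c₀)| * A u) := by simp only [hS]; ring
      _ ≤ (2 * ((((n : ℕ) : ℕ) : ℝ) ^ 4)⁻¹ * D u) * ((((m + 1 : ℕ) : ℝ)) ^ 4 * (P * Real.exp (-r * l1 (u - c₀)))) :=
          mul_le_mul_of_nonneg_left (hWA u) (by have := hD0 u; positivity)
      _ = 2 * P * Real.exp (-r * l1 (u - c₀)) * D u * (((((m + 1 : ℕ) : ℝ)) ^ 4)⁻¹ * (((m + 1 : ℕ) : ℝ)) ^ 4) := by rw [hn]; ring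
      _ = 2 * P * Real.exp (-r * l1 (u - c₀)) * D u := by rw [inv_mul_cancel₀ hn4.ne', mul_one]
  -- summability from the crude `D u ≤ 2n⁴`
  have hDcr : ∀ u, D u ≤ ((n : ℕ) : ℝ) ^ 4 * (((n : ℕ) : ℝ) ^ 4 * (2 * (((n : ℕ) : ℝ) ^ 4)⁻¹)) := fun u => D_le ρ n κ' u (blk (n - 1) u)
  have hmaj : Summable fun u => 2 * P * Real.exp (-r * l1 (u - c₀)) * (((n : ℕ) : ℝ) ^ 4 * (((n : ℕ) : ℝ) ^ 4 * (2 * (((n : ℕ) : ℝ) ^ 4)⁻¹))) :=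
    (((summable_exp_shift' hr0 c₀).mul_left (2 * P)).mul_right
      (((n : ℕ) : ℝ) ^ 4 * (((n : ℕ) : ℝ) ^ 4 * (2 * (((n : ℕ) : ℝ) ^ 4)⁻¹)))).congr fun u => by ring
  have hSs : Summable S := Summable.of_nonneg_of_le hS0 (fun u => (hS1 u).trans (mul_le_mul_of_nonneg_left (hDcr u) (by positivity))) hmaj
  refine ⟨hSs, ?_⟩
  -- block averaging: on the block `β`, `S u ≤ 2·P·e^{κ₁/2}·n⁻⁴·E β·D_β u`
  have hS2 : ∀ β, ∀ u ∈ B (n - 1) β, S u ≤ 2 * P * (Real.exp (kappa163 (3 + 1) / (3 + 1) / 2) * (((((m + 1 : ℕ) : ℝ)) ^ 4)⁻¹ * E β)) *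
      ∑ x ∈ B (n - 1) β, ∑ z' ∈ B (n - 1) β, (|qJetAt ρ n κ' u β z'| + |qJetAt ρ n κ' u β x|) := by
    intro β u hu
    have hβ : blk (n - 1) u = β := mem_B.1 hu
    have hav := exp_le_blockAvg m c₀ u
    rw [← hr] at hav
    have hDu : D u = ∑ x ∈ B (n - 1) β, ∑ z' ∈ B (n - 1) β, (|qJetAt ρ n κ' u β z'| + |qJetAt ρ n κ' u β x|) := by simp only [hD, hβ]
    have hEu : ∑ u' ∈ B (m + 1 - 1) (blk (m + 1 - 1) u), Real.exp (-r * l1 (u' - c₀)) = E β := by simp only [hE, hn] at hβ ⊢; rw [hβ]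
    rw [hEu] at hav
    calc S u ≤ 2 * P * Real.exp (-r * l1 (u - c₀)) * D u := hS1 u
      _ ≤ 2 * P * (Real.exp (kappa163 (3 + 1) / (3 + 1) / 2) * (((((m + 1 : ℕ) : ℝ)) ^ 4)⁻¹ * E β)) * D u :=
          mul_le_mul_of_nonneg_right (mul_le_mul_of_nonneg_left hav (by positivity)) (hD0 u)
      _ = _ := by rw [hDu]
  have hblock : ∀ β, ∑ u ∈ B (n - 1) β, S u ≤ (2 * P * (Real.exp (kappa163 (3 + 1) / (3 + 1) / 2) * ((((m + 1 : ℕ) : ℝ)) ^ 4)⁻¹) *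
      (2 * (((n : ℕ) : ℝ) ^ 4 * (((n : ℕ) : ℝ) ^ 4 * ((((n : ℕ) : ℝ) - 1) * (((n : ℕ) : ℝ) ^ 4)⁻¹))))) * E β := by
    intro β
    have hDs := sum_B_D_le n κ' hρ β
    calc ∑ u ∈ B (n - 1) β, S u
        ≤ ∑ u ∈ B (n - 1) β, 2 * P * (Real.exp (kappa163 (3 + 1) / (3 + 1) / 2) * (((((m + 1 : ℕ) : ℝ)) ^ 4)⁻¹ * E β)) *
            ∑ x ∈ B (n - 1) β, ∑ z' ∈ B (n - 1) β, (|qJetAt ρ n κ' u β z'| + |qJetAt ρ n κ' u β x|) := Finset.sum_le_sum (hS2 β)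
      _ = 2 * P * (Real.exp (kappa163 (3 + 1) / (3 + 1) / 2) * (((((m + 1 : ℕ) : ℝ)) ^ 4)⁻¹ * E β)) *
            ∑ u ∈ B (n - 1) β, ∑ x ∈ B (n - 1) β, ∑ z' ∈ B (n - 1) β, (|qJetAt ρ n κ' u β z'| + |qJetAt ρ n κ' u β x|) := by
          rw [← Finset.mul_sum]
      _ ≤ 2 * P * (Real.exp (kappa163 (3 + 1) / (3 + 1) / 2) * (((((m + 1 : ℕ) : ℝ)) ^ 4)⁻¹ * E β)) *
            (2 * (((n : ℕ) : ℝ) ^ 4 * (((n : ℕ) : ℝ) ^ 4 * ((((n : ℕ) : ℝ) - 1) * (((n : ℕ) : ℝ) ^ 4)⁻¹)))) :=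
          mul_le_mul_of_nonneg_left hDs (by have := hE0 β; positivity)
      _ = _ := by ring
  have he : Summable fun u : Site 4 => Real.exp (-r * l1 (u - c₀)) := summable_exp_shift' hr0 c₀
  have hEsum : Summable E := (hasSum_blocks (n - 1) he.hasSum).summable
  have hEt : ∑' β, E β = Zl 4 r := by rw [hE, ← tsum_eq_tsum_blocks (n - 1) he, tsum_exp_shift']
  have hSt : ∑' u, S u = ∑' β, ∑ u ∈ B (n - 1) β, S u := tsum_eq_tsum_blocks (n - 1) hSs
  have hBs : Summable fun β => ∑ u ∈ B (n - 1) β, S u := (hasSum_blocks (n - 1) hSs.hasSum).summable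
  set L : ℝ := (2 * P * (Real.exp (kappa163 (3 + 1) / (3 + 1) / 2) * ((((m + 1 : ℕ) : ℝ)) ^ 4)⁻¹) *
      (2 * (((n : ℕ) : ℝ) ^ 4 * (((n : ℕ) : ℝ) ^ 4 * ((((n : ℕ) : ℝ) - 1) * (((n : ℕ) : ℝ) ^ 4)⁻¹))))) with hL
  have hn1' : (0 : ℝ) ≤ ((n : ℕ) : ℝ) - 1 := by rw [hn]; push_cast; linarith
  have hL0 : 0 ≤ L := by positivity
  have hZ := Zl_kappa_le m
  rw [← hr] at hZ
  have hZ0 : 0 ≤ Zl 4 r := Zl_nonneg hr0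
  have eκ : Real.exp (kappa163 (3 + 1) / (3 + 1) / 2) * Real.exp (kappa163 (3 + 1) / (3 + 1) / 2) = Real.exp (kappa163 (3 + 1) / (3 + 1)) := by
    rw [← Real.exp_add]; ring_nf
  have hMP : 0 ≤ (MG163 (3 + 1) * periodConst (kappa163 (3 + 1)) 3) * Real.exp (kappa163 (3 + 1) / (3 + 1)) := by
    have h := hC0
    rw [hC, mul_assoc] at h
    exact (mul_nonneg_iff_of_pos_left (inv_pos.2 (pow_pos hn0 (3 + 2)))).1 h
  -- `C²·(n − 1)·n⁴ ≤ (M·P·e^{κ₁})²·(n⁵)⁻¹`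
  have hCn : C * C * ((((n : ℕ) : ℝ) - 1) * ((n : ℕ) : ℝ) ^ 4)
      ≤ ((MG163 (3 + 1) * periodConst (kappa163 (3 + 1)) 3) * Real.exp (kappa163 (3 + 1) / (3 + 1))) ^ 2 * ((((m + 1 : ℕ) : ℝ)) ^ 5)⁻¹ := by
    rw [hC, hn]
    have hvol : ((((m + 1 : ℕ) : ℝ)) ^ (3 + 2))⁻¹ * ((((m + 1 : ℕ) : ℝ)) ^ (3 + 2))⁻¹ * ((((m + 1 : ℕ) : ℝ) - 1) * ((m + 1 : ℕ) : ℝ) ^ 4)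
        ≤ ((((m + 1 : ℕ) : ℝ)) ^ 5)⁻¹ := by
      rw [show (3 + 2 : ℕ) = 5 from rfl, mul_assoc]
      refine mul_le_of_le_one_right (by positivity) ?_
      rw [inv_mul_le_iff₀ (by positivity), mul_one]
      have e : ((((m + 1 : ℕ) : ℝ)) - 1) * ((m + 1 : ℕ) : ℝ) ^ 4 = (((m + 1 : ℕ) : ℝ)) ^ 5 - (((m + 1 : ℕ) : ℝ)) ^ 4 := by ring
      rw [e]; linarith [pow_pos hn0 4]
    calc ((((m + 1 : ℕ) : ℝ)) ^ (3 + 2))⁻¹ * (MG163 (3 + 1) * periodConst (kappa163 (3 + 1)) 3) * Real.exp (kappa163 (3 + 1) / (3 + 1)) *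
          (((((m + 1 : ℕ) : ℝ)) ^ (3 + 2))⁻¹ * (MG163 (3 + 1) * periodConst (kappa163 (3 + 1)) 3) * Real.exp (kappa163 (3 + 1) / (3 + 1))) *
          ((((m + 1 : ℕ) : ℝ) - 1) * ((m + 1 : ℕ) : ℝ) ^ 4)
        = (((((m + 1 : ℕ) : ℝ)) ^ (3 + 2))⁻¹ * ((((m + 1 : ℕ) : ℝ)) ^ (3 + 2))⁻¹ * ((((m + 1 : ℕ) : ℝ) - 1) * ((m + 1 : ℕ) : ℝ) ^ 4)) *
            ((MG163 (3 + 1) * periodConst (kappa163 (3 + 1)) 3) * Real.exp (kappa163 (3 + 1) / (3 + 1))) ^ 2 := by ring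
      _ ≤ ((((m + 1 : ℕ) : ℝ)) ^ 5)⁻¹ * ((MG163 (3 + 1) * periodConst (kappa163 (3 + 1)) 3) * Real.exp (kappa163 (3 + 1) / (3 + 1))) ^ 2 :=
          mul_le_mul_of_nonneg_right hvol (sq_nonneg _)
      _ = _ := mul_comm _ _
  calc ∑' u, S u = ∑' β, ∑ u ∈ B (n - 1) β, S u := hSt
    _ ≤ ∑' β, L * E β := hBs.tsum_le_tsum hblock (hEsum.mul_left L)
    _ = L * Zl 4 r := by rw [tsum_mul_left, hEt]
    _ = 4 * (Real.exp (kappa163 (3 + 1) / (3 + 1) / 2) * Real.exp (kappa163 (3 + 1) / (3 + 1) / 2)) *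
          (C * C * ((((n : ℕ) : ℝ) - 1) * ((n : ℕ) : ℝ) ^ 4)) * (((((m + 1 : ℕ) : ℝ)) ^ 4)⁻¹ * Zl 4 r) *
          Real.exp (-(kappa163 (3 + 1) / (3 + 1) / 8) * l1 z) *
          (((((m + 1 : ℕ) : ℝ)) ^ 4)⁻¹ * (((m + 1 : ℕ) : ℝ)) ^ 4) := by
        rw [hL, hP, hn]; ring
    _ = 4 * (Real.exp (kappa163 (3 + 1) / (3 + 1) / 2) * Real.exp (kappa163 (3 + 1) / (3 + 1) / 2)) *
          (C * C * ((((n : ℕ) : ℝ) - 1) * ((n : ℕ) : ℝ) ^ 4)) * (((((m + 1 : ℕ) : ℝ)) ^ 4)⁻¹ * Zl 4 r) *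
          Real.exp (-(kappa163 (3 + 1) / (3 + 1) / 8) * l1 z) := by
        rw [inv_mul_cancel₀ (by positivity), mul_one]
    _ ≤ 4 * Real.exp (kappa163 (3 + 1) / (3 + 1)) *
          (((MG163 (3 + 1) * periodConst (kappa163 (3 + 1)) 3) * Real.exp (kappa163 (3 + 1) / (3 + 1))) ^ 2 * ((((m + 1 : ℕ) : ℝ)) ^ 5)⁻¹) *
          (1 + 16 / (kappa163 (3 + 1) / (3 + 1))) ^ 4 * Real.exp (-(kappa163 (3 + 1) / (3 + 1) / 8) * l1 z) := by
        rw [eκ]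
        have h1 : 0 ≤ C * C * ((((n : ℕ) : ℝ) - 1) * ((n : ℕ) : ℝ) ^ 4) := by positivity
        have h2 : 0 ≤ ((((m + 1 : ℕ) : ℝ)) ^ 4)⁻¹ * Zl 4 r := by positivity
        refine mul_le_mul_of_nonneg_right ?_ (Real.exp_pos _).le
        exact mul_le_mul (mul_le_mul_of_nonneg_left hCn (by positivity)) hZ h2 (by positivity)
    _ = _ := by ring

end StencilSum

/-! ## §3 The packed table -/

section Table
variable (m : ℕ)

/-- [folklore] The packed second-order table is the finite sum over colour PAIRS of double superpositions (kernel level). -/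
theorem tableRedF_eq_sum_pairs {F : Type*} (n : ℕ) [NeZero n] (T : Fin 4 → Site 4 → Fin 4 → Site 4 → MKer 4 F) (μ : Fin 4) (y : Site 4)
    (ν : Fin 4) (y' : Site 4) :
    tableRedF n T μ y ν y' = ∑ q ∈ (Finset.univ : Finset (Fin 4)) ×ˢ (Finset.univ : Finset (Fin 4)),
      wsum (fun u => wH (N := n) (d := 3) q.1 μ (u - (n : ℤ) • y))
        (fun u => wsum (fun u' => wH (N := n) (d := 3) q.2 ν (u' - (n : ℤ) • y')) (T q.1 u q.2)) := by
  funext x z a b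
  simp only [tableRedF_apply, Finset.sum_apply, Finset.sum_product]

/-- [folklore] **THE PACKED STRIPPED SQUARE TABLE'S PLAIN MASS**: for an in-block root `ρ` and every coarse `z`, the plain ℓ¹-mass of
`tableRedF n (qSqAt ρ n) μ 0 ν z` is summable and `≤ 64·e^{κ₁}·(M·P·e^{κ₁})²·(1 + 16∕κ₁)⁴ · (n⁵)⁻¹ · e^{−(κ₁∕8)|z|₁}` — **power `n⁻⁵`**, coarse decay
rate `κ₁∕8` (sixteen colour pairs × `tsum_wH_tableStencilMass_le`). -/
theorem mass_tableRedF_qSqAt_le {ρ : Site 4} (hρ : ∀ i : Fin 4, 0 ≤ ρ i ∧ ρ i < (m + 1 : ℕ)) (μ ν : Fin 4) (z : Site 4) :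
    (Summable fun p : Site 4 × Site 4 => ∑ a, ∑ b, |tableRedF (m + 1) (qSqAt ρ (m + 1)) μ 0 ν z p.1 p.2 a b|) ∧
      ∑' p : Site 4 × Site 4, ∑ a, ∑ b, |tableRedF (m + 1) (qSqAt ρ (m + 1)) μ 0 ν z p.1 p.2 a b|
        ≤ 64 * Real.exp (kappa163 (3 + 1) / (3 + 1)) *
            ((MG163 (3 + 1) * periodConst (kappa163 (3 + 1)) 3) * Real.exp (kappa163 (3 + 1) / (3 + 1))) ^ 2 * (1 + 16 / (kappa163 (3 + 1) / (3 + 1))) ^ 4 *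
          ((((m + 1 : ℕ) : ℝ)) ^ 5)⁻¹ * Real.exp (-(kappa163 (3 + 1) / (3 + 1) / 8) * l1 z) := by
  set Tz : ℝ := 4 * Real.exp (kappa163 (3 + 1) / (3 + 1)) *
      ((MG163 (3 + 1) * periodConst (kappa163 (3 + 1)) 3) * Real.exp (kappa163 (3 + 1) / (3 + 1))) ^ 2 * (1 + 16 / (kappa163 (3 + 1) / (3 + 1))) ^ 4 *
      ((((m + 1 : ℕ) : ℝ)) ^ 5)⁻¹ * Real.exp (-(kappa163 (3 + 1) / (3 + 1) / 8) * l1 z) with hTz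
  -- one colour pair
  have hpair : ∀ q : Fin 4 × Fin 4,
      (Summable fun p : Site 4 × Site 4 => ∑ a, ∑ b,
        |wsum (fun u => wH (N := m + 1) (d := 3) q.1 μ (u - ((m + 1 : ℕ) : ℤ) • (0 : Site 4)))
          (fun u => wsum (fun u' => wH (N := m + 1) (d := 3) q.2 ν (u' - ((m + 1 : ℕ) : ℤ) • z)) (qSqAt ρ (m + 1) q.1 u q.2)) p.1 p.2 a b| * (1 : ℝ)) ∧
      ∑' p : Site 4 × Site 4, ∑ a, ∑ b,
        |wsum (fun u => wH (N := m + 1) (d := 3) q.1 μ (u - ((m + 1 : ℕ) : ℤ) • (0 : Site 4)))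
          (fun u => wsum (fun u' => wH (N := m + 1) (d := 3) q.2 ν (u' - ((m + 1 : ℕ) : ℤ) • z)) (qSqAt ρ (m + 1) q.1 u q.2)) p.1 p.2 a b| * (1 : ℝ) ≤ Tz := by
    rintro ⟨κ', l'⟩
    have hT := tsum_wH_tableStencilMass_le m hρ κ' l' μ ν z
    have h := mass_wsum_le (F := Unit) (W := fun _ => (1 : ℝ)) (fun _ => one_pos)
      (fun u => (mass_innerWsum_qSqAt_le ρ (m + 1) κ' l' (fun u' => wH (N := m + 1) (d := 3) l' ν (u' - ((m + 1 : ℕ) : ℤ) • z)) u).1)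
      (fun u => (mass_innerWsum_qSqAt_le ρ (m + 1) κ' l' (fun u' => wH (N := m + 1) (d := 3) l' ν (u' - ((m + 1 : ℕ) : ℤ) • z)) u).2) hT.1
    exact ⟨h.1, h.2.trans hT.2⟩
  rw [tableRedF_eq_sum_pairs]
  have h := mass_finset_sum_le (F := Unit) (W := fun _ => (1 : ℝ)) ((Finset.univ : Finset (Fin 4)) ×ˢ (Finset.univ : Finset (Fin 4)))
    (fun _ => zero_le_one) (fun q _ => (hpair q).1) (fun q _ => (hpair q).2)
  refine ⟨h.1.congr fun p => by simp only [mul_one], ?_⟩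
  have e : ∑' p : Site 4 × Site 4, ∑ a, ∑ b, |(∑ q ∈ (Finset.univ : Finset (Fin 4)) ×ˢ (Finset.univ : Finset (Fin 4)),
      wsum (fun u => wH (N := m + 1) (d := 3) q.1 μ (u - ((m + 1 : ℕ) : ℤ) • (0 : Site 4)))
        (fun u => wsum (fun u' => wH (N := m + 1) (d := 3) q.2 ν (u' - ((m + 1 : ℕ) : ℤ) • z)) (qSqAt ρ (m + 1) q.1 u q.2))) p.1 p.2 a b|
      = ∑' p : Site 4 × Site 4, ∑ a, ∑ b, |(∑ q ∈ (Finset.univ : Finset (Fin 4)) ×ˢ (Finset.univ : Finset (Fin 4)),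
      wsum (fun u => wH (N := m + 1) (d := 3) q.1 μ (u - ((m + 1 : ℕ) : ℤ) • (0 : Site 4)))
        (fun u => wsum (fun u' => wH (N := m + 1) (d := 3) q.2 ν (u' - ((m + 1 : ℕ) : ℤ) • z)) (qSqAt ρ (m + 1) q.1 u q.2))) p.1 p.2 a b| * (1 : ℝ) :=
    tsum_congr fun p => by simp only [mul_one]
  rw [e]
  refine h.2.trans (le_of_eq ?_)
  rw [Finset.sum_const, Finset.card_product, Finset.card_univ, Fintype.card_fin, nsmul_eq_mul, hTz]
  push_cast
  ring

end Table

end Summit.QuantumFields.BalabanUV.Beta.D1BFx.GhostDeltaTableMass
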